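import Literature.Probability.Percolation.Crossings
import Literature.Probability.Percolation.SitePaths
import Literature.Probability.LatticeModels.TriangularLattice

/-!
# Cell clusters are triangular site clusters: path conversions (support item `SmirnovCellAnchor`)

Helper file for `Summit.CriticalPhenomena.CardyFormulaZ2.Theses.ModulusResponse.SmirnovCellAnchor`
(stmt-CriticalPhenomena-6471). For the one-layer cell configuration
`Φ X = {left and down edges of the sites of X}` on `ℤ²` (pinned by a hypothesis `hΦ`):

* an open `𝕋`-path of sites of `X` (`triGraph`: `ℤ²` with the diagonal `(1, -1)`) yields an open
  nearest-neighbour bond path of `Φ X` through the same sites and the intermediate corner vertices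
  `w` of the diagonal steps (`w + e₀`, `w + e₁` are consecutive path sites):
  `pathIn_openGraph_of_pathIn_triGraph`;
* a `𝕋`-path of closed sites (off `X`) yields a dual-open nearest-neighbour path of
  `dualConfig (Φ X)` through the dual vertices `m - (1, 1)` of its sites `m` and the same kind of
  intermediate vertices: `pathIn_dual_of_pathIn_triGraph`.

This is the bookkeeping behind "μ_0-clusters are the site clusters of `triGraph`" in the route text.
-/

noncomputable section

namespace Summit.CriticalPhenomena.CardyFormulaZ2.Theorems.SmirnovCellAnchor

open Set
open Literature.Probability.Percolation Literature.Probability.LatticeModels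

/-! ### Lattice vector bookkeeping -/

/-- The diagonal of the triangular lattice is `e₀ - e₁`. [folklore] -/
theorem triDiag_eq : triDiag = Pi.single 0 1 - Pi.single 1 1 := by
  ext j; fin_cases j <;> simp [triDiag]

/-- `e₀ ≠ e₁` in `ℤ²`. [folklore] -/
theorem single_zero_ne_single_one : (Pi.single 0 1 : Site 2) ≠ Pi.single 1 1 := by
  intro h; have := congrFun h 0; simp at this

/-- `e₀ + e₁ ≠ 0` in `ℤ²`. [folklore] -/
theorem single_add_single_ne_zero : (Pi.single 0 1 : Site 2) + Pi.single 1 1 ≠ 0 := by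
  intro h; have := congrFun h 0; simp at this

/-- `eᵢ ≠ 0` in `ℤ²`. [folklore] -/
theorem single_ne_zero (i : Fin 2) : (Pi.single i 1 : Site 2) ≠ 0 := by
  intro h; have := congrFun h i; simp at this

/-- The lattice edges `{m - eᵢ, m}` determine `m` and `i`. [folklore] -/
theorem edge_eq_edge_iff {m m' : Site 2} {i i' : Fin 2} :
    s(m - Pi.single i 1, m) = s(m' - Pi.single i' 1, m') ↔ m = m' ∧ i = i' := by
  constructor
  · intro h
    rw [Sym2.eq_iff] at h
    rcases h with ⟨h1, h2⟩ | ⟨h1, h2⟩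
    · subst h2
      refine ⟨rfl, ?_⟩
      have h3 : (Pi.single i 1 : Site 2) = Pi.single i' 1 := by
        have := congrArg (fun v => m - v) h1
        simpa using this
      by_contra hii
      have := congrFun h3 i
      simp [hii] at this
    · -- `m - eᵢ = m'` and `m = m' - e_{i'}` force `eᵢ + e_{i'} = 0`
      exfalso
      have h3 : (Pi.single i 1 : Site 2) + Pi.single i' 1 = 0 := by
        have e1 : m' = m - Pi.single i 1 := h1.symm
        rw [e1] at h2
        linear_combination h2
      have := congrFun h3 i
      fin_cases i <;> fin_cases i' <;> simp at this
  · rintro ⟨rfl, rfl⟩; rfl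

/-- The dual edge of an open edge at a site: `dualEdge {m - e₀, m} = {m - 𝟙, m - 𝟙 + e₁}` and
`dualEdge {m - e₁, m} = {m - 𝟙, m - 𝟙 + e₀}` (`𝟙 = (1,1)`); stated as: it is one of the two lattice
edges out of `m - 𝟙`. [folklore] -/
theorem dualEdge_edge (m : Site 2) (i : Fin 2) :
    ∃ k : Fin 2, dualEdge s(m - Pi.single i 1, m) = s(m - 1, m - 1 + Pi.single k 1) := by
  match i with
  | 0 =>
    refine ⟨1, ?_⟩
    have h := dualEdge_horizontal' (m - Pi.single 0 1)
    rw [sub_add_cancel] at h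
    rw [h]
    congr 1 <;> rw [one_eq_single_add_single] <;> abel
  | 1 =>
    refine ⟨0, ?_⟩
    have h := dualEdge_vertical' (m - Pi.single 1 1)
    rw [sub_add_cancel] at h
    rw [h]
    congr 1 <;> rw [one_eq_single_add_single] <;> abel

/-! ### Membership in the cell configuration -/

variable (Φ : Set (Site 2) → BondConfig (Site 2))
  (hΦ : ∀ X, Φ X = {e | ∃ m ∈ X, e = s(m - Pi.single 0 1, m) ∨ e = s(m - Pi.single 1 1, m)})

include hΦ

/-- Membership in the cell configuration: an edge is open iff it is the left or down edge of a site
of `X`. [folklore] -/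
theorem mem_cell_iff {X : Set (Site 2)} {e : Sym2 (Site 2)} :
    e ∈ Φ X ↔ ∃ m ∈ X, ∃ i : Fin 2, e = s(m - Pi.single i 1, m) := by
  rw [hΦ]
  simp only [mem_setOf_eq]
  constructor
  · rintro ⟨m, hm, h | h⟩
    · exact ⟨m, hm, 0, h⟩
    · exact ⟨m, hm, 1, h⟩
  · rintro ⟨m, hm, i, h⟩
    refine ⟨m, hm, ?_⟩
    fin_cases i
    · exact Or.inl h
    · exact Or.inr h

/-- The edge `{m - eᵢ, m}` is open iff `m ∈ X`. [folklore] -/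
theorem edge_mem_cell_iff {X : Set (Site 2)} {m : Site 2} {i : Fin 2} :
    s(m - Pi.single i 1, m) ∈ Φ X ↔ m ∈ X := by
  rw [mem_cell_iff Φ hΦ]
  constructor
  · rintro ⟨m', hm', i', h⟩
    rw [edge_eq_edge_iff] at h
    rw [h.1]; exact hm'
  · intro hm; exact ⟨m, hm, i, rfl⟩

/-- Every open edge is a lattice edge. [folklore] -/
theorem cell_subset_edgeSet (X : Set (Site 2)) : Φ X ⊆ (zdGraph 2).edgeSet := by
  intro e he
  obtain ⟨m, -, i, rfl⟩ := (mem_cell_iff Φ hΦ).1 he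
  have := single_edge_mem (m - Pi.single i 1) i
  rwa [sub_add_cancel] at this

/-- The open graph of the cell configuration joins `m - eᵢ` to `m` when `m ∈ X` (and this is a
nearest-neighbour edge). [folklore] -/
theorem adj_sub_single {X : Set (Site 2)} {m : Site 2} (hm : m ∈ X) (i : Fin 2) :
    (openGraph (Φ X) ⊓ zdGraph 2).Adj (m - Pi.single i 1) m := by
  rw [SimpleGraph.inf_adj, openGraph_adj, zdGraph_adj_iff]
  refine ⟨⟨(edge_mem_cell_iff Φ hΦ).2 hm, fun h => single_ne_zero i ?_⟩, ⟨i, Or.inl (sub_add_cancel _ _).symm⟩⟩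
  have := congrArg (fun v => m - v) h
  simp at this

/-- Symmetric form of `adj_sub_single`. [folklore] -/
theorem adj_sub_single' {X : Set (Site 2)} {m : Site 2} (hm : m ∈ X) (i : Fin 2) :
    (openGraph (Φ X) ⊓ zdGraph 2).Adj m (m - Pi.single i 1) :=
  (adj_sub_single Φ hΦ hm i).symm

/-! ### Open `𝕋`-paths of sites give open bond paths -/

/-- **An open `𝕋`-path of sites of `X` inside `S` is an open bond path of `Φ X`** inside
`S ∪ {w | w + e₀ ∈ S ∧ w + e₁ ∈ S}` (the diagonal step `m ∼ m + (1,-1)` is realised by the two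
open edges at the corner `w = m - e₁`, the step `m ∼ m + (-1,1)` by the corner `w = m - e₀`).
[folklore] -/
theorem pathIn_openGraph_of_pathIn_triGraph {X S : Set (Site 2)} (hS : S ⊆ X) {u v : Site 2}
    (hP : PathIn triGraph S u v) :
    PathIn (openGraph (Φ X) ⊓ zdGraph 2)
      (S ∪ {w | w + Pi.single 0 1 ∈ S ∧ w + Pi.single 1 1 ∈ S}) u v := by
  obtain ⟨hu, h⟩ := hP
  refine ⟨Or.inl hu, ?_⟩
  induction h with
  | refl => exact Relation.ReflTransGen.refl
  | @tail b c hab hbc ih =>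
    have hb : b ∈ S := by
      have := (PathIn.right_mem (G := triGraph) ⟨hu, hab⟩ : b ∈ S); exact this
    have hc : c ∈ S := hbc.2
    have hbX := hS hb
    have hcX := hS hc
    rcases (triGraph_adj_iff b c).1 hbc.1 with hzd | hdiag | hdiag
    · -- nearest-neighbour step
      refine ih.tail ⟨?_, Or.inl hc⟩
      obtain ⟨i, h | h⟩ := (zdGraph_adj_iff b c).1 hzd
      · have : b = c - Pi.single i 1 := by rw [h, add_sub_cancel_right]
        rw [this]; exact adj_sub_single Φ hΦ hcX i
      · have : c = b - Pi.single i 1 := by rw [h, add_sub_cancel_right]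
        rw [this]; exact adj_sub_single' Φ hΦ hbX i
    · -- `c = b + (1,-1)`: through `w = b - e₁ = c - e₀`
      have hw1 : b - Pi.single 1 1 + Pi.single 1 1 = b := sub_add_cancel _ _
      have hw0 : b - Pi.single 1 1 + Pi.single 0 1 = c := by rw [hdiag, triDiag_eq]; abel
      have hwc : b - Pi.single 1 1 = c - Pi.single 0 1 := by rw [← hw0]; abel
      refine (ih.tail ⟨adj_sub_single' Φ hΦ hbX 1, Or.inr ⟨?_, ?_⟩⟩).tail ⟨?_, Or.inl hc⟩
      · rw [hw0]; exact hc
      · rw [hw1]; exact hb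
      · rw [hwc]; exact adj_sub_single Φ hΦ hcX 0
    · -- `b = c + (1,-1)`: through `w = b - e₀ = c - e₁`
      have hw0 : b - Pi.single 0 1 + Pi.single 0 1 = b := sub_add_cancel _ _
      have hw1 : b - Pi.single 0 1 + Pi.single 1 1 = c := by rw [hdiag, triDiag_eq]; abel
      have hwc : b - Pi.single 0 1 = c - Pi.single 1 1 := by rw [← hw1]; abel
      refine (ih.tail ⟨adj_sub_single' Φ hΦ hbX 0, Or.inr ⟨?_, ?_⟩⟩).tail ⟨?_, Or.inl hc⟩
      · rw [hw0]; exact hb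
      · rw [hw1]; exact hc
      · rw [hwc]; exact adj_sub_single Φ hΦ hcX 1

/-! ### Closed `𝕋`-paths of sites give dual-open paths -/

/-- **At a closed site both dual edges out of `m - 𝟙` are dual-open**: for `m ∉ X` the edges
`{m - 𝟙, m - 𝟙 + e_k}` (`k = 0, 1`) belong to `dualConfig (Φ X)`. [folklore] -/
theorem dual_adj_of_not_mem {X : Set (Site 2)} {m : Site 2} (hm : m ∉ X) (k : Fin 2) :
    (openGraph (dualConfig (Φ X)) ⊓ zdGraph 2).Adj (m - 1) (m - 1 + Pi.single k 1) := by
  rw [SimpleGraph.inf_adj, openGraph_adj, zdGraph_adj_iff]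
  refine ⟨⟨?_, fun h => single_ne_zero k ?_⟩, ⟨k, Or.inl rfl⟩⟩
  · rw [mem_dualConfig_iff]
    refine ⟨single_edge_mem _ _, fun e' he' heq => ?_⟩
    obtain ⟨m', hm', i, rfl⟩ := (mem_cell_iff Φ hΦ).1 he'
    obtain ⟨k', hk'⟩ := dualEdge_edge m' i
    rw [hk'] at heq
    -- `{m' - 𝟙, m' - 𝟙 + e_{k'}} = {m - 𝟙, m - 𝟙 + e_k}` forces `m' = m`
    rw [show s(m' - 1, m' - 1 + Pi.single k' 1) =
        s(m' - 1 + Pi.single k' 1 - Pi.single k' 1, m' - 1 + Pi.single k' 1) by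
          rw [add_sub_cancel_right],
      show s(m - 1, m - 1 + Pi.single k 1) =
        s(m - 1 + Pi.single k 1 - Pi.single k 1, m - 1 + Pi.single k 1) by
          rw [add_sub_cancel_right], edge_eq_edge_iff] at heq
    obtain ⟨h1, h2⟩ := heq
    subst h2
    have : m' = m := by
      have := congrArg (fun v => v - Pi.single k' 1 + 1) h1
      simpa using this
    exact hm (this ▸ hm')
  · have := congrArg (fun v => v - (m - 1)) h
    simp at this
    exact this.symm

/-- **A `𝕋`-path of closed sites inside `S` gives a dual-open nearest-neighbour path** of
`dualConfig (Φ X)` from `u - 𝟙` to `v - 𝟙` inside `{d | d + 𝟙 ∈ S} ∪ {w | w + e₀ ∈ S ∧ w + e₁ ∈ S}`.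
[folklore] -/
theorem pathIn_dual_of_pathIn_triGraph {X S : Set (Site 2)} (hS : S ⊆ Xᶜ) {u v : Site 2}
    (hP : PathIn triGraph S u v) :
    PathIn (openGraph (dualConfig (Φ X)) ⊓ zdGraph 2)
      ({d | d + 1 ∈ S} ∪ {w | w + Pi.single 0 1 ∈ S ∧ w + Pi.single 1 1 ∈ S}) (u - 1) (v - 1) := by
  obtain ⟨hu, h⟩ := hP
  refine ⟨Or.inl (by rw [mem_setOf_eq, sub_add_cancel]; exact hu), ?_⟩
  induction h with
  | refl => exact Relation.ReflTransGen.refl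
  | @tail b c hab hbc ih =>
    have hb : b ∈ S := by
      have := (PathIn.right_mem (G := triGraph) ⟨hu, hab⟩ : b ∈ S); exact this
    have hc : c ∈ S := hbc.2
    have hbX : b ∉ X := hS hb
    have hcX : c ∉ X := hS hc
    have hcmem : c - 1 ∈ ({d | d + 1 ∈ S} ∪ {w | w + Pi.single 0 1 ∈ S ∧ w + Pi.single 1 1 ∈ S}) :=
      Or.inl (by rw [mem_setOf_eq, sub_add_cancel]; exact hc)
    rcases (triGraph_adj_iff b c).1 hbc.1 with hzd | hdiag | hdiag
    · refine ih.tail ⟨?_, hcmem⟩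
      obtain ⟨i, h | h⟩ := (zdGraph_adj_iff b c).1 hzd
      · have e : c - 1 = b - 1 + Pi.single i 1 := by rw [h]; abel
        rw [e]; exact dual_adj_of_not_mem Φ hΦ hbX i
      · have e : b - 1 = c - 1 + Pi.single i 1 := by rw [h]; abel
        rw [e]; exact (dual_adj_of_not_mem Φ hΦ hcX i).symm
    · -- `c = b + (1,-1)`: `b - 𝟙 → b - 𝟙 + e₀ = c - 𝟙 + e₁ → c - 𝟙`
      have e1 : b - 1 + Pi.single 0 1 = c - 1 + Pi.single 1 1 := by rw [hdiag, triDiag_eq]; abel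
      have hw0 : b - 1 + Pi.single 0 1 + Pi.single 0 1 = c := by
        rw [hdiag, triDiag_eq, one_eq_single_add_single]; abel
      have hw1 : b - 1 + Pi.single 0 1 + Pi.single 1 1 = b := by
        rw [one_eq_single_add_single]; abel
      refine (ih.tail ⟨dual_adj_of_not_mem Φ hΦ hbX 0, Or.inr ⟨?_, ?_⟩⟩).tail ⟨?_, hcmem⟩
      · rw [hw0]; exact hc
      · rw [hw1]; exact hb
      · rw [e1]; exact (dual_adj_of_not_mem Φ hΦ hcX 1).symm
    · -- `b = c + (1,-1)`: `b - 𝟙 → b - 𝟙 + e₁ = c - 𝟙 + e₀ → c - 𝟙`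
      have e1 : b - 1 + Pi.single 1 1 = c - 1 + Pi.single 0 1 := by rw [hdiag, triDiag_eq]; abel
      have hw0 : b - 1 + Pi.single 1 1 + Pi.single 0 1 = b := by
        rw [one_eq_single_add_single]; abel
      have hw1 : b - 1 + Pi.single 1 1 + Pi.single 1 1 = c := by
        rw [hdiag, triDiag_eq, one_eq_single_add_single]; abel
      refine (ih.tail ⟨dual_adj_of_not_mem Φ hΦ hbX 1, Or.inr ⟨?_, ?_⟩⟩).tail ⟨?_, hcmem⟩
      · rw [hw0]; exact hb
      · rw [hw1]; exact hc
      · rw [e1]; exact (dual_adj_of_not_mem Φ hΦ hcX 0).symm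

end Summit.CriticalPhenomena.CardyFormulaZ2.Theorems.SmirnovCellAnchor

end
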